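import Mathlib
import HarnessLib
import HarnessLib.Audit
import Summits.RiemannHypothesis.Statement
import Literature.NumberTheory.Transcendental.PeriodsWave0
import Literature.NumberTheory.LFunctions.ColossallyAbundant

/-!
Route: Robin

CLOSED (superseded) 2026-08-15T10:38:52Z by planner-RiemannHypothesis-route-RiemannHypothesis-Robin-0 — reason: superseded:route-RiemannHypothesis-InterimWave0 — superseded by route-RiemannHypothesis-InterimWave0 — note: route-repair (guardrail, 2026-08-15): closed as REFORMULATION, superseded by route-RiemannHypothesis-InterimWave0 (items 0030 RobinIff = robin_iff verbatim, 0031 LagariasIff, 0028 theta-form of RH). Census: every item of this route is settled or RH itself in landed Literature — X <-> RH is the THEOR. The file is kept as the record of this route; refuted decls are indexed as negative knowledge (`ledger negatives`).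

# Route Robin — the elementary Π⁰₁ face: extremal divisor sums at colossally abundant numbers

**Thesis X (words).** Robin's inequality: `σ(n) < e^γ n log log n` for every `n > 5040`.

**X (Lean, elaborated; Mathlib only).**
`∀ n : ℕ, 5040 < n → ((ArithmeticFunction.sigma 1 n : ℕ) : ℝ) < Real.exp
Real.eulerMascheroniConstant * n * Real.log (Real.log n)`

**Assembly.** X → RH is Robin's theorem [Robin1984 Thm 1–2] (¬RH ⇒ the inequality fails for
infinitely many n, via
Ω-oscillations of Chebyshev's θ from an off-line zero) — a NAMED FACT (cite filed). Lagarias' γ-free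
form
`σ(n) < H_n + e^{H_n} log H_n (n > 1)` [Lagarias2002] is filed as an equivalent face.

**Why this line (imports: combinatorial/convex structure of extremal numbers + transcendence
theory).** This is the
only RH-equivalent that is a `∀ n : ℕ` statement about an elementary computable function, so it is
the entry point
for (a) exhaustive certified computation with structure (all n ≤ 10^{10^{13.1}} are covered via CA
numbers and RH to
height 3·10^{12} [MorrillPlatt2021 §1]; t-free n for t ≤ 20 [CLMS2007; MorrillPlatt2021]) and (b)
the extremal
theory: a violation, if any, occurs at a COLOSSALLY ABUNDANT number [Robin1984 §3 Prop.], and CA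
numbers form an
explicit chain `n_1 | n_2 | …` parametrised by ε whose successive quotients are a prime or a product
of two primes —
and are ALWAYS prime under the Four Exponentials Conjecture [AlaogluErdos1944 Thm]
(`Literature.NumberTheory.Transcendental.FourExponentialsConjecture`
exists in Literature). So the route couples RH to the transcendence trunk of this same tree: along a
prime-step CA
chain, `σ(n_{k+1})/n_{k+1} = (σ(n_k)/n_k)(1 + 1/(p + … ))` is a telescoping product over primes and
X becomes an
explicit-PNT statement `∏_{p≤x}(1 - 1/p)^{-1}` vs `e^γ log θ(x)`-type (Mertens/Nicolas), i.e. `θ(x)`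
vs `x` with error
`O(√x log² x)`. Honest limitation: that last step is von Koch's RH-equivalent, so the route's own
leverage is the
reduction of a Π⁰₁ statement over all n to a sparse explicit chain plus a transcendence conjecture —
worth staffing
cheaply, not a main line.

**Ranked cruxes.**
- #2 (informal, needs definition `Nat.ColossallyAbundant`) X restricted to colossally abundant n >
5040 — RH-strength
  by Robin's reduction; the extremal-structure target.
- #3 (informal, needs the same definition) Robin's reduction itself: X ↔ (X on CA numbers)
[Robin1984 §3] — provable
  once the definition lands (elementary convexity: σ(n)/(n log log n) is maximised on CA numbers
between consecutive
  CA numbers, for n > 5040).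
- #4 (informal, needs the same definition) Alaoglu–Erdős: `FourExponentialsConjecture →` the
quotient of consecutive
  CA numbers is prime — the transcendence import; structural lemma for attacking #2 along the chain.
- #5 Lagarias face → RH: `(∀ n > 1, σ(n) < H_n + exp(H_n) log(H_n)) → Summit.RiemannHypothesis`
(fact-backed;
  dedup anchor for provers preferring the γ-free form).

**Kill criteria.** (i) A certified n > 5040 violating X refutes RH (necessarily n > 10^{10^{13}}:
only reachable via
the CA chain, which is why #2/#4 exist). (ii) Close as reformulation if, after
`Nat.ColossallyAbundant` lands and #3 is
proved, the refuter shows #2 along the CA chain is verbatim von Koch's `θ(x) = x + O(√x log²x)` with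
no residual
combinatorial content (then merge into route Strip / explicit-formula work).

**Not decomposed yet.** No explicit-PNT items (Schoenfeld/Büthe bounds), no superabundant vs CA
comparison, no
Kalmár/Nicolas `n/φ(n)` variant (Nicolas' criterion) — add only if #3 lands.

UNDER FLOOR: fewer than 2 cruxes remain after retriage (legacy route; D-0019).

Rationale: brief=widen: elementary Pi01 face; extremal (colossally abundant) structure + transcendence link via
FourExponentialsConjecture (Alaoglu–Erdős); cheap route, not a main line

Novelty: Nearest prior art (lit search/frontier/read, 2026-08-14): the thesis is Robin1984 Thm 1 verbatim
(tree: Literature.NumberTheory.LFunctions.robin_iff; its hard half is now proved outright,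
Literature.NumberTheory.LFunctions.riemannHypothesis_of_robinInequality); the reduction to
colossally abundant n is Robin1984 §3 Prop 1 (tree: Robin1984_prop1_holds) and is exactly how
Briggs2006 §4 and MorrillPlatt2021 (arXiv:1809.10813 Thm 13) verify X up to 10^(10^13.099); the
FourExponentials ⇒ prime-quotient link is AlaogluErdos1944 §3 p.455 with Lagarias2002 §2 (tree:
Nat.caSeq_div_prime_of_fourExponentials); attacking X along the prime-step CA chain by telescoping
σ₋₁-ratios against loglog-ratios under that very transcendence assumption is arXiv:1308.3678 (2013
preprint, inconclusive), with kindred sparse-subsequence criteria in arXiv:1211.2147,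
arXiv:1306.3434 (extremely abundant numbers) and CaveneyNicolasSondow2012 (GA/CA extremality,
arXiv:1112.6010); the least CA exception is confined to a band in arXiv:2510.23889. Delta: none in
mechanism — expected grade known. What the route adds is organisational: the Π⁰₁ face as a Lean
dedup anchor whose every non-crux item is now dischargeable from landed Literature (RobinCriterion,
RobinNumerical, ColossallyAbundantQuotient, NicolasOmega), isolating RobinAtColossallyAbundant = RH
on one explicit sparse divisibility chain as the single open statement. No cross-field import beyond
the conditional, purely structural FourExp link (it shapes th  [refs: 1809.10813, 1308.3678, 1211.2147, 1306.3434, 1112.6010, 2510.23889, Robin1984, Briggs2006, MorrillPlatt2021, AlaogluErdos1944, Lagarias2002, CaveneyNicolasSondow2012]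

Barriers (technique_class: Robin-criterion colossally-abundant square-root-error-term): Literature.Barriers.RiemannHypothesis.LittlewoodOscillation — hits the endgame: along CA numbers X
is θ(x) vs x at scale √x log²x (RobinColossallyAbundantRH.lean: Schoenfeld1976_theta under RH), i.e.
von Koch strength; evaded only in the weak sense that X is RH-EQUIVALENT (robin_iff), never a
strengthening: no one-signed or o(√x) error term is asserted, and the margin e^γ·loglog N − σ(N)/N
at CA numbers itself oscillates at order (log N)^(-1/2) (Robin1984 §4; arXiv:1308.3678 p3).
Literature.Barriers.RiemannHypothesis.DiamondMontgomeryVorhauer2006_thm1 — NOT evaded: the route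
uses no structure of ℤ unavailable to Beurling systems except integrality of exponents in the CA
parametrisation; the (weak) bet is that extremal combinatorics of CA numbers carries such
information; no evidence. Literature.Barriers.RiemannHypothesis.MertensDisproof,
Literature.Barriers.RiemannHypothesis.LiouvilleSignConjectures,
Literature.Barriers.RiemannHypothesis.TuranPartialSums (false elementary inequalities implying RH) —
do not apply to X, which is PROVED equivalent to RH; they do warn against support strengthenings
along the chain (monotonicity of G at consecutive CA numbers already fails at 5040 → 55440;
'R_t(p_n#) decreasing' is only wished for, arXiv:1809.10813 §5).
Literature.Barriers.RiemannHypothesis.DavenportHeilbronn — respected trivially: σ and the CA chain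
live on the Euler-product side. Uncatalogued: arXiv:1809.10813 §5 (t-free analytic method saturates
at the RH-verification height).

History (route lifecycle, newest last):
- 2026-08-15T10:38:52Z · CLOSED superseded — superseded:route-RiemannHypothesis-InterimWave0 (planner-RiemannHypothesis-route-RiemannHypothesis-Robin-0)

sub-problem: RiemannHypothesis · status: closed(superseded) · opened planner-RiemannHypothesis-Survey-0 2026-08-13T06:12:44Z · rev 1 · ledger route-RiemannHypothesis-Robin
GENERATED by the gate from the ledger (D-0016/17). Provers cite these decls: `theorem foo : Summit.RiemannHypothesis.RiemannHypothesis.Theses.Robin.<Decl> := …` in Summits/RiemannHypothesis/RiemannHypothesis/Theorems/<Name>.lean.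
-/

namespace Summit.RiemannHypothesis.RiemannHypothesis.Theses.Robin

open scoped BigOperators Topology Manifold Classical MeasureTheory ProbabilityTheory Matrix InnerProductSpace ComplexConjugate ContinuousMap
open Filter Set Function TopologicalSpace MeasureTheory

attribute [summit_statement] _root_.Summit.RiemannHypothesis

open Summit

/-- item stmt-RiemannHypothesis-0399 · target · rank 0 · closed · moot by None · by planner
why it might fail: X ⇔ RH (Literature.NumberTheory.LFunctions.robin_iff; X ⇒ RH is even proved outright in-tree: Literature.NumberTheory.LFunctions.riemannHypothesis_of_robinInequality). X is false iff ζ has a zero off the line: then σ(n) > e^γ n log log n at infinitely many colossally abundant n (Robin1984_sigma_osci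
sources: Robin1984, Thm 1 and §4 Prop 1, Literature.NumberTheory.LFunctions.robin_iff (Literature/NumberTheory/LFunctions/RHClassicalEquivalents.lean; named fact, rh.S24), Literature.NumberTheory.LFunctions.riemannHypothesis_of_robinInequality + Literature.NumberTheory.LFunctions.Robin1984_sigma_oscillation_holds (Literature/NumberTheory/LFunctions/NicolasOmega.lean:1126, :1096; unconditional), arXiv:1809.10813 p6 Thm 13 (MorrillPlatt2021: X holds for 5040 < n ≤ 10^(10^13.099), checked along the CA chain; Briggs2006 §4 to 10^(10^10)), paper:doi-10-1090-mcom-3687 p2 (Saouter, Math. Comp. 2021: a violator of X has ≥ 9.65·10^11 distinct prime factors)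
Thesis X of route Robin: for every n > 5040, σ(n) < e^γ · n · log log n (ArithmeticFunction.sigma 1,
Real.eulerMascheroniConstant). RH ↔ X [Robin1984 Thms 1–2]; rh.S24 of the inventory (declaration
absent from RHWave0). Known: X for all 20-free n and for all n ≤ 10^(10^13.099) [MorrillPlatt2021;
CLMS2007]; a violation, if any, occurs at a colossally abundant number [Robin1984 §3]. -/
@[route_item "route-RiemannHypothesis-Robin"]
def RobinThesis : Prop :=
  ∀ n : ℕ, 5040 < n → ((ArithmeticFunction.sigma 1 n : ℕ) : ℝ) < Real.exp Real.eulerMascheroniConstant * n * Real.log (Real.log n)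

/-- item stmt-RiemannHypothesis-0401 · crux · rank 2 · closed · moot by None · by planner
why it might fail: Equivalent to RH, hence exactly as hard: (X on CA) ⇒ X is Robin §3 Prop 1 (in-tree Robin1984_prop1_holds + robinInequality_le_55440), X ⇒ RH is proved (riemannHypothesis_of_robinInequality), RH ⇒ it is the CA case of Robin Thm 1. False iff RH is; reaching it needs |θ(x)−x| ≪ √x log²x-strength input.
sources: Robin1984, §3 (proof of Thm 1, colossally abundant case) and §3 Prop 1, Literature.NumberTheory.LFunctions.Robin1984_thm1_colossallyAbundant_of_nicolas (Literature/NumberTheory/LFunctions/RobinColossallyAbundantRH.lean:65: RH ⇒ this item, from Nicolas2012_logf_lower + Schoenfeld1976_theta + Briggs2006 facts), Literature.NumberTheory.LFunctions.Robin1984_prop1_holds (ColossallyAbundantStructure.lean:310) + Literature.NumberTheory.LFunctions.robinInequality_le_55440 (RobinNumerical.lean:511): this item ⇒ X, arXiv:2510.23889 p2 (Zimov 2025: if RH fails the least CA exception n lies in the band e^γ < G(n) < e^γ(1 + c/(log n)^b), 0 < b < 1/2), arXiv:1308.3678 pp2-3 (2013 preprint: attack on X along the prime-step CA chain via σ₋₁-ratio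 vs loglog-ratio products, assuming the Alaoglu–Erdős/FourExp prime quotient; inconclusive), arXiv:1809.10813 p6 Thm 13 + Briggs2006 §4 (no CA violator below 10^(10^13.099))
needs_definition: Nat.ColossallyAbundant (n is colossally abundant if ∃ ε > 0, ∀ m ≥ 1, σ(m)/m^{1+ε}
≤ σ(n)/n^{1+ε} [AlaogluErdos1944 §5; Robin1984 §3]). Statement: ∀ n, Nat.ColossallyAbundant n → 5040
< n → σ(n) < e^γ n log log n. RH-strength (equivalent to X by crux #3, Robin's reduction). The
extremal-structure target: CA numbers form an explicit divisibility chain parametrised by ε with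
prime-or-semiprime steps, so this is a statement along one explicit sparse sequence, where σ(n)/n
telescopes into a Mertens-type product over primes [Robin1984 §§2–3; Lagarias2002 §3]. -/
@[route_item "route-RiemannHypothesis-Robin"]
def RobinAtColossallyAbundant : Prop :=
  ∀ n : ℕ, Nat.ColossallyAbundant n → 5040 < n → ((ArithmeticFunction.sigma 1 n : ℕ) : ℝ) < Real.exp Real.eulerMascheroniConstant * n * Real.log (Real.log n)

/-- item stmt-RiemannHypothesis-0402 · support · rank 3 · closed · moot by None · by planner
sources: Robin1984, §3 Prop 1 (= Broughan2017 Lemma 7.1 per arXiv:2510.23889 p4 Thm 1; Axler2017 §2), Literature.NumberTheory.LFunctions.Robin1984_thm1_of_parts (RobinCriterion.lean:359) with Literature.NumberTheory.LFunctions.Robin1984_prop1_holds, Literature.NumberTheory.LFunctions.robinInequality_le_55440, Nat.colossallyAbundant_55440_holds, Nat.setOf_colossallyAbundant_infinite_holds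
needs_definition: Nat.ColossallyAbundant. Statement: (∀ n > 5040, σ(n) < e^γ n log log n) ↔ (∀ n
colossally abundant, n > 5040 → σ(n) < e^γ n log log n). [Robin1984 §3, Proposition 1]: if the
inequality fails at some n > 5040 it fails at a colossally abundant number ≥ n's neighbourhood;
proof is elementary convexity of log(σ(n)/n) against log n along the CA chain (Alaoglu–Erdős), plus
the check 5040 < next CA number = 55440 region handled by finite computation. Provable once the
definition lands; makes #2 ↔ X formal. -/
@[route_item "route-RiemannHypothesis-Robin"]
def RobinReductionToCA : Prop :=
  (∀ n : ℕ, 5040 < n → ((ArithmeticFunction.sigma 1 n : ℕ) : ℝ) < Real.exp Real.eulerMascheroniConstant * n * Real.log (Real.log n)) ↔ (∀ n : ℕ, Nat.ColossallyAbundant n → 5040 < n → ((ArithmeticFunction.sigma 1 n : ℕ) : ℝ) < Real.exp Real.eulerMascheroniConstant * n * Real.log (Real.log n))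

/-- item stmt-RiemannHypothesis-0403 · support · rank 4 · closed · moot by None · by planner
sources: AlaogluErdos1944, §3 p.455 (remark after Thm 10); Lagarias2002, §2 pp537-538, Nat.caSeq_div_prime_of_fourExponentials (Literature/NumberTheory/LFunctions/ColossallyAbundantQuotient.lean:1084)
needs_definition: Nat.ColossallyAbundant (and the increasing enumeration caSeq : ℕ → ℕ of CA
numbers). Statement: Literature.NumberTheory.Transcendental.FourExponentialsConjecture → ∀ k,
Nat.Prime (caSeq (k+1) / caSeq k) ∧ caSeq k ∣ caSeq (k+1). [AlaogluErdos1944, Thm 8 and the remark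
following it: unconditionally the quotient is a prime or a product of two distinct primes; it is
always prime provided p^x and q^x are not both rational for distinct primes p, q and irrational x —
a special case of the four exponentials conjecture (Lang 1966; Waldschmidt2000 §1.3)]. Transcendence
import; structural lemma for attacking #2 along a prime-step chain. Not on the implication chain to
X; filed as the cross-trunk link (Transcendental ↔ RH). -/
@[route_item "route-RiemannHypothesis-Robin"]
def RobinAlaogluErdosFourExp : Prop :=
  Literature.NumberTheory.Transcendental.FourExponentialsConjecture → ∀ k : ℕ, Nat.Prime (Nat.caSeq (k + 1) / Nat.caSeq k) ∧ Nat.caSeq k ∣ Nat.caSeq (k + 1)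

/-- item stmt-RiemannHypothesis-0404 · support · rank 5 · closed · moot by None · by planner
sources: Lagarias2002, Thm 1.1 (⇐ direction, proof §3 via Robin §4 Prop 1 + Lemma 3.2), Literature.NumberTheory.LFunctions.riemannHypothesis_of_lagariasInequality (Literature/NumberTheory/LFunctions/NicolasOmega.lean:1145; unconditional) and Literature.NumberTheory.LFunctions.lagarias_iff (RHClassicalEquivalents.lean)
Lagarias' γ-free elementary criterion [Lagarias2002 Thm 1.1]: RH ↔ ∀ n ≥ 1, σ(n) ≤ H_n + exp(H_n)
log(H_n), with equality only at n = 1 (H_n = harmonic n, Mathlib `harmonic : ℕ → ℚ`). Direction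
(inequality ⇒ RH) goes through Robin's theorem (Lagarias §3: the bound implies Robin's for n > 5040
up to an explicit finite check). rh.S25 of the inventory, declaration absent. Dedup anchor; expected
discharge via named facts lagarias_criterion / robin_criterion (cites filed). -/
@[route_item "route-RiemannHypothesis-Robin"]
def RobinLagariasFace : Prop :=
  (∀ n : ℕ, 1 < n → ((ArithmeticFunction.sigma 1 n : ℕ) : ℝ) < (harmonic n : ℝ) + Real.exp (harmonic n : ℝ) * Real.log (harmonic n : ℝ)) → Summit.RiemannHypothesis

/-- item stmt-RiemannHypothesis-0400 · assembly · rank 1 · closed · moot by None · by planner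
Robin's theorem, direction X ⇒ RH [Robin1984 Thm 2 / §4]: if RH fails with a zero of real part β >
1/2, Ω-oscillations of θ(x) − x of size x^{β−ε} (Landau/Ingham with Robin's explicit constants)
force σ(n)/(n log log n) > e^γ for infinitely many colossally abundant n. Expected discharge with
the named fact robin_criterion (cite filed): (h : robin_criterion) → this. -/
@[route_item "route-RiemannHypothesis-Robin"]
def Assembly : Prop :=
  (∀ n : ℕ, 5040 < n → ((ArithmeticFunction.sigma 1 n : ℕ) : ℝ) < Real.exp Real.eulerMascheroniConstant * n * Real.log (Real.log n)) → Summit.RiemannHypothesis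

end Summit.RiemannHypothesis.RiemannHypothesis.Theses.Robin
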